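import Mathlib
import Summits.KontsevichZagierPeriods.KontsevichZagierPeriods.Theses.SymplecticScissors
import Literature.NumberTheory.Transcendental.CurvePeriods
import Literature.NumberTheory.Transcendental.CurvePeriodsEllipticSegmentsProofs
import Literature.NumberTheory.Transcendental.AnalyticSubgroupElliptic

/-!
# Sketch — crux-ideate round 1, ideator 3 (gen 2), crux `SymplecticScissors.RealOnePeriodRelations`
(stmt-KontsevichZagierPeriods-10042)

First lemmas of the idea card `isogeny-descent-small-loops`, stated over existing declarations
(no proofs claimed except the `Iff.rfl` sanity check `crux_iff` and `M₁'_le_M₁`).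

* `SmallLoopCone`   — a ℚ-semialgebraic `C¹` loop inside ONE graph-chart disc of a smooth affine
                       curve realises `0 mod M₁` (ONE typed Green instance: the cone
                       `P(a,b) = c + (a+b)²·(ẑ(b/(a+b)) − c)` with quadratic vertex flattening).
* `HalvingLift`     — division of a null-homotopic loop on `E_L` by `2ᵏ` (after an algebraic
                       translation) is again a ℚ-SEMIALGEBRAIC `CurvePath` (continuous selection
                       along the étale isogeny `[2ᵏ]`), although `φ = (℘, ℘′/2)` is transcendental.
* `DescentIdentityTheta0` — `θ₀(γ)γ′ = 2ᵏ · θ₀(ε_k)ε_k′` pointwise (`φ^*θ₀ = 2 dz`): rule 1b.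
* `LoopLemmaE`, `LoopLemmaGm` — the unconditional targets: null-homotopic (resp. winding-zero)
                       semialgebraic loops on `E_L` (resp. `𝔾ₘ`) realise `0 mod M₁` for every polynomial
                       form over `ℚ̄` and every algebraic scalar. AST-free, HW-free.
-/

noncomputable section

open scoped BigOperators
open Set MeasureTheory

namespace Summit.KontsevichZagierPeriods.KontsevichZagierPeriods.Cruxes.RealOnePeriodRelations.Ideator3g2

open Literature.NumberTheory.Transcendental
open Literature.NumberTheory.Transcendental.CurvePeriods

/-! ## The crux, unfolded (verbatim copies) -/

/-- The Green generator set of the crux, verbatim. -/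
def greenSet : Set KZ.FormalRep :=
  {g : KZ.FormalRep | ∃ (Δ : Set (Fin 2 → ℝ)) (A B S : (Fin 2 → ℝ) → ℝ)
    (r₀₁ r₁₂ r₀₂ : KZ.IntegralRep 1), Δ = {p | 0 ≤ p 0 ∧ 0 ≤ p 1 ∧ p 0 + p 1 ≤ 1} ∧
    IsSemialgebraicFunOn ℚ Δ A ∧ IsSemialgebraicFunOn ℚ Δ B ∧ ContinuousOn A Δ ∧ ContinuousOn B Δ ∧
    (∀ p : Fin 2 → ℝ, 0 < p 0 → 0 < p 1 → p 0 + p 1 < 1 →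
      HasFDerivAt S (A p • ContinuousLinearMap.proj (R := ℝ) (φ := fun _ : Fin 2 => ℝ) 0 +
        B p • ContinuousLinearMap.proj (R := ℝ) (φ := fun _ : Fin 2 => ℝ) 1) p) ∧
    r₀₁.domain = {z | z 0 ∈ Set.Ioo 0 1} ∧ r₁₂.domain = {z | z 0 ∈ Set.Ioo 0 1} ∧
    r₀₂.domain = {z | z 0 ∈ Set.Ioo 0 1} ∧ (∀ z ∈ r₀₁.domain, r₀₁.integrand z = A ![z 0, 0]) ∧
    (∀ z ∈ r₁₂.domain, r₁₂.integrand z = B ![1 - z 0, z 0] - A ![1 - z 0, z 0]) ∧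
    (∀ z ∈ r₀₂.domain, r₀₂.integrand z = B ![0, z 0]) ∧
    g = KZ.of r₀₁ + KZ.of r₁₂ - KZ.of r₀₂}

/-- The move group of the crux: rules 1a, 1b, 2 and the Green generator. -/
def M₁ : AddSubgroup KZ.FormalRep :=
  AddSubgroup.closure (KZ.domainAddRel ∪ KZ.integrandAddRel ∪ KZ.changeOfVariablesRel ∪ greenSet)

/-- The dimension-one move group (no Green). -/
def M₁' : AddSubgroup KZ.FormalRep :=
  AddSubgroup.closure (KZ.domainAddRel ∪ KZ.integrandAddRel ∪ KZ.changeOfVariablesRel)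

/-- Formal combinations of 1-dimensional representations. -/
def H₁ : AddSubgroup KZ.FormalRep :=
  AddSubgroup.closure (Set.range fun r : KZ.IntegralRep 1 => KZ.of r)

/-- Sanity: the crux is literally `∀ c ∈ H₁, eval c = 0 → c ∈ M₁`. -/
theorem crux_iff :
    Theses.SymplecticScissors.RealOnePeriodRelations ↔ ∀ c ∈ H₁, KZ.eval c = 0 → c ∈ M₁ :=
  Iff.rfl

theorem M₁'_le_M₁ : M₁' ≤ M₁ :=
  AddSubgroup.closure_mono Set.subset_union_left

/-! ## Realisation of (scaled) symbols by real 1-dimensional representations (as in ideator 3, gen 1) -/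

/-- `ℂⁿ` as `ℝ²ⁿ` (real parts, then imaginary parts). -/
def realify {n : ℕ} (v : Fin n → ℂ) : Fin (n + n) → ℝ :=
  Fin.append (fun i => (v i).re) (fun i => (v i).im)

/-- A path `γ : [0,1] → ℂⁿ` is `ℚ`-semialgebraic. -/
def IsSAPath {n : ℕ} (γ : ℝ → (Fin n → ℂ)) : Prop :=
  IsSemialgebraicMapOn ℚ {z : Fin 1 → ℝ | z 0 ∈ Icc (0 : ℝ) 1} (fun z => realify (γ (z 0)))

/-- The complex integrand `ω(γ(t)) · γ′(t)` of a period symbol. -/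
def pathIntegrand {n : ℕ} (ω : Fin n → MvPolynomial (Fin n) ℂ) (γ : ℝ → (Fin n → ℂ)) (t : ℝ) : ℂ :=
  ∑ i, MvPolynomial.eval (γ t) (ω i) * deriv (fun u => γ u i) t

/-- `r` realises `Re (a · ∫_γ ω)` as `∫₀¹ Re(a · ω(γ(t)) γ′(t)) dt`. -/
def Realises (r : KZ.IntegralRep 1) (a : ℂ) {n : ℕ} (ω : Fin n → MvPolynomial (Fin n) ℂ)
    (γ : ℝ → (Fin n → ℂ)) : Prop :=
  r.domain = {z | z 0 ∈ Ioo (0 : ℝ) 1} ∧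
    ∀ z ∈ r.domain, r.integrand z = (a * pathIntegrand ω γ (z 0)).re

/-! ## The multiplicative group and the two notions of "null loop" (no homotopy theory needed) -/

/-- `𝔾ₘ = {xy = 1} ⊂ 𝔸²` in the rendering of the tree (`isSmoothAffineCurve_mulGroup`). -/
abbrev mulGroup : CurveData := ⟨2, 1, ![MvPolynomial.X 0 * MvPolynomial.X 1 - 1]⟩

/-- A loop on `E_L` is NULL-HOMOTOPIC in `E_L(ℂ)` iff its lift through `φ = (℘, ℘′/2)` (which
exists: `Ell.exists_lift`) closes up. -/
def IsNullLoopE (L : PeriodPair) (γ : CurvePath (Ell.curve L)) : Prop :=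
  ∃ γt : ℝ → ℂ, ContinuousOn γt (Icc (0 : ℝ) 1) ∧ (∀ t ∈ Icc (0 : ℝ) 1, γt t ∉ L.lattice) ∧
    (∀ t ∈ Icc (0 : ℝ) 1, Ell.phi L (γt t) = γ.toFun t) ∧ γt 0 = γt 1

/-- A loop on `𝔾ₘ` has WINDING NUMBER ZERO iff a continuous logarithm of its first coordinate
(which exists: `CurvePeriodsLogLiftProofs`) closes up. -/
def IsNullLoopGm (γ : CurvePath mulGroup) : Prop :=
  ∃ lg : ℝ → ℂ, ContinuousOn lg (Icc (0 : ℝ) 1) ∧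
    (∀ t ∈ Icc (0 : ℝ) 1, Complex.exp (lg t) = γ.toFun t 0) ∧ lg 0 = lg 1

/-! ## First lemma A: `SmallLoopCone` — a small loop in ONE chart disc is ONE typed Green instance

Data as in the graph charts delivered by `CurveData.IsSmoothAffineCurve.exists_localChart`
(`ψ` analytic on a disc, a section of the coordinate `i₀`, landing in `Z`), plus the
`ℚ`-semialgebraicity of the chart graph. For a `ℚ`-semialgebraic loop `ẑ : [0,1] → disc`,
`C¹` on `[0,1]`, based at the centre `c`, the realisation of `Re(a · ψ^*ω)` along `ẑ` lies in
`M₁`: the single Green instance is the CONE `P(a,b) = c + (a+b)²·(ẑ(b/(a+b)) − c)`, whose two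
straight edges are constant (integrand `0`) and whose hypotenuse is the loop; the quadratic
flattening makes `∂_aP = 2(a+b)(ẑ−c) − b ẑ′`, `∂_bP = 2(a+b)(ẑ−c) + a ẑ′` tend to `0` at the
vertex, so `A = Re(a g(P) ∂_aP)`, `B = Re(a g(P) ∂_bP)` are continuous on the CLOSED triangle
(tightness `green_unsound_without_vertex_continuity` of Disproof.lean §4 honoured); the potential
is `S = Re(a F∘P)`, `F′ = g := ψ^*ω/dw` holomorphic on the disc. -/
def SmallLoopCone : Prop :=
  ∀ (Z : CurveData) (_hZ : Z.IsSmoothAffineCurve) (ω : Fin Z.n → MvPolynomial (Fin Z.n) ℂ)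
    (_hω : ∀ i, HasAlgCoeffs (ω i)) (a : ℂ) (_ha : IsAlgebraic ℚ a)
    (i₀ : Fin Z.n) (c : ℂ) (ρ : ℝ) (ψ : ℂ → (Fin Z.n → ℂ)),
    0 < ρ → AnalyticOnNhd ℂ ψ (Metric.ball c ρ) → MapsTo ψ (Metric.ball c ρ) Z.points →
    (∀ w ∈ Metric.ball c ρ, ψ w i₀ = w) →
    IsSemialgebraicMapOn ℚ {q : Fin 2 → ℝ | (⟨q 0, q 1⟩ : ℂ) ∈ Metric.ball c ρ}
      (fun q => realify (ψ ⟨q 0, q 1⟩)) →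
    ∀ (zh : ℝ → ℂ),
      IsSemialgebraicMapOn ℚ {q : Fin 1 → ℝ | q 0 ∈ Icc (0 : ℝ) 1} (fun q => ![(zh (q 0)).re, (zh (q 0)).im]) →
      ContDiffOn ℝ 1 zh (Icc (0 : ℝ) 1) → zh 0 = c → zh 1 = c → MapsTo zh (Icc (0 : ℝ) 1) (Metric.ball c ρ) →
    ∀ r : KZ.IntegralRep 1, Realises r a ω (fun t => ψ (zh t)) → KZ.of r ∈ M₁

/-! ## First lemma B: `HalvingLift` — dividing a translated null-homotopic loop by `2ᵏ` stays
ℚ-semialgebraic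

`t ↦ φ(w₀ + (γ̃(t) − γ̃(0))/2ᵏ)` is the continuous lift, starting at the algebraic point `φ(w₀)`,
of the translate `τ_S ∘ γ` (`S = φ(2ᵏw₀ − γ̃(0))`, algebraic) along the étale isogeny `[2ᵏ]`;
as a continuous selection from the finite semialgebraic correspondence `{(t, Q) | [2ᵏ]Q = τ_S γ(t)}`
it is ℚ-semialgebraic (cell decomposition over `[0,1]`), `C¹` because `[2ᵏ]` is étale, with
algebraic end points (`2ᵏ`-division points of algebraic points are algebraic). -/
def HalvingLift : Prop :=
  ∀ (L : PeriodPair), IsAlgebraic ℚ L.g₂ → IsAlgebraic ℚ L.g₃ →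
    ∀ (γ : CurvePath (Ell.curve L)) (γt : ℝ → ℂ), IsSAPath γ.toFun →
      ContinuousOn γt (Icc (0 : ℝ) 1) → (∀ t ∈ Icc (0 : ℝ) 1, γt t ∉ L.lattice) →
      (∀ t ∈ Icc (0 : ℝ) 1, Ell.phi L (γt t) = γ.toFun t) → γt 0 = γt 1 →
    ∀ (w₀ : ℂ) (k : ℕ), (∀ i, IsAlgebraic ℚ (Ell.phi L w₀ i)) →
      (∀ t ∈ Icc (0 : ℝ) 1, w₀ + (γt t - γt 0) / 2 ^ k ∉ L.lattice) →
      ∃ ε : CurvePath (Ell.curve L), IsSAPath ε.toFun ∧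
        ∀ t ∈ Icc (0 : ℝ) 1, ε.toFun t = Ell.phi L (w₀ + (γt t - γt 0) / 2 ^ k)

/-! ## First lemma C: `DescentIdentityTheta0` — the integrand identity behind rule 1b

Both integrands are computed through `φ^*θ₀ = 2 dz` (`Ell.fderiv_mul_theta0_apply`,
`Weier.z_one_mul_theta0_apply`): `θ₀(γ)γ′ = 2γ̃′` and `θ₀(ε)ε′ = 2γ̃′/2ᵏ`. (For `θ₁ = x dx/y` the
identity holds up to the derivative of a RATIONAL function of `ε(t)` — the division-polynomial
correction `[2ᵏ]^*θ₁ = 2ᵏθ₁ + dH_k`, cf. the tree's `Ell.span_descent_theta1` — i.e. up to a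
dimension-one Newton–Leibniz term on a loop, which is `≡ 0 mod M₁'`.) -/
def DescentIdentityTheta0 : Prop :=
  ∀ (L : PeriodPair) (γ ε : CurvePath (Ell.curve L)) (γt : ℝ → ℂ) (w₀ : ℂ) (k : ℕ),
    ContDiffOn ℝ 1 γt (Icc (0 : ℝ) 1) → (∀ t ∈ Icc (0 : ℝ) 1, γt t ∉ L.lattice) →
    (∀ t ∈ Icc (0 : ℝ) 1, Ell.phi L (γt t) = γ.toFun t) →
    (∀ t ∈ Icc (0 : ℝ) 1, w₀ + (γt t - γt 0) / 2 ^ k ∉ L.lattice) →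
    (∀ t ∈ Icc (0 : ℝ) 1, ε.toFun t = Ell.phi L (w₀ + (γt t - γt 0) / 2 ^ k)) →
    ∀ t ∈ Ioo (0 : ℝ) 1,
      pathIntegrand (Ell.theta0 L) γ.toFun t = 2 ^ k * pathIntegrand (Ell.theta0 L) ε.toFun t

/-! ## The unconditional targets: loop lemmas on `E_L` and on `𝔾ₘ` (AST-free, HW-free)

`LoopLemmaE`: translate + `HalvingLift` + `DescentIdentityTheta0` (+ the `θ₁` correction and the
reduction `ω ∼ αθ₀ + βθ₁ + dP + ν` of `Weier.exists_reduction`, all pointwise / dimension one) +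
`SmallLoopCone` in a graph chart around `φ(w₀)` for `k` large (the divided loops shrink like `2⁻ᵏ`).
`LoopLemmaGm`: the same with the `N`-th root branch `δ = (δ_N)ᴺ`, `dz/z ↦ N dz/z`, cone at `1`. -/
def LoopLemmaE : Prop :=
  ∀ (L : PeriodPair), IsAlgebraic ℚ L.g₂ → IsAlgebraic ℚ L.g₃ →
    ∀ (γ : CurvePath (Ell.curve L)), IsSAPath γ.toFun → IsNullLoopE L γ →
    ∀ (ω : Fin 2 → MvPolynomial (Fin 2) ℂ), (∀ i, HasAlgCoeffs (ω i)) →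
    ∀ (a : ℂ), IsAlgebraic ℚ a → ∀ r : KZ.IntegralRep 1, Realises r a ω γ.toFun → KZ.of r ∈ M₁

@[inherit_doc LoopLemmaE]
def LoopLemmaGm : Prop :=
  ∀ (γ : CurvePath mulGroup), IsSAPath γ.toFun → IsNullLoopGm γ →
    ∀ (ω : Fin 2 → MvPolynomial (Fin 2) ℂ), (∀ i, HasAlgCoeffs (ω i)) →
    ∀ (a : ℂ), IsAlgebraic ℚ a → ∀ r : KZ.IntegralRep 1, Realises r a ω γ.toFun → KZ.of r ∈ M₁

/-! ## How the engine plugs into the AST-quotient certificate (typed layer, value side PROVED)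

The value-side input of the typed layer is the tree's PROVED
`analyticSubgroupTheorem_GaGmE_holds : analyticSubgroupTheorem_GaGmE` (dichotomy form). Each
degeneracy it outputs — an integer relation among logarithms `y`, or among elliptic logarithms
`z` — is, on the path side, a loop satisfying `IsNullLoopGm` (the product loop `∏ δᵢ^{pᵢ}`) or
`IsNullLoopE` (the group-law sum `Σ [aₖ] ρₖ`, translated off `O`), whose realisation is the
corresponding `ℤ`-combination of the given representations by rule 1b (invariance of `dz/z`,
`θ₀`; `θ₁` up to exact rational corrections). So `LoopLemmaGm ∧ LoopLemmaE` are exactly the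
2-dimensional content of that layer. We record the dependency as an implication statement. -/
def EngineForLayer : Prop :=
  Literature.NumberTheory.Transcendental.analyticSubgroupTheorem_GaGmE → LoopLemmaGm → LoopLemmaE → True

example : EngineForLayer := fun _ _ _ => trivial

end Summit.KontsevichZagierPeriods.KontsevichZagierPeriods.Cruxes.RealOnePeriodRelations.Ideator3g2

end
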